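import Summits.CriticalPhenomena.Ising3DConformalLimit.Theorems.PrecisionLaplacianMoebiusLimitOfTwoPointLawInversionBegetsDilations
import Literature.Probability.LatticeModels.HighDimPointwiseTriviality
import HarnessLib

/-!
# K2, part 1 — the WEIGHTED word: translations and one weighted unit inversion dilate every correlation
# family with a CONSTANT cocycle (crux `ExistsContinuousLimit`, item stmt-CriticalPhenomena-4582, line
# `Sketch` = idea `inversion-before-existence`; `--supports stmt-CriticalPhenomena-4582`, registered sub-goal
# `dilation_const_of_pos` of stub `stub_inversionBegetsDilation`)

For a translation-invariant `S : CorrFamily 3` with positive two-point function off the diagonal that is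
covariant under the unit inversion `ι y = y/‖y‖²` with SOME positive weight `w`
(`S n (ι ∘ x) = (∏ w (x i)) · S n x` off the origin): for every `c > 0` there is `K > 0` with
`S n (c x) = Kⁿ S n x` for all `n`, `x` (`dilation_const_of_pos`). Part 2
(`…InversionBegetsDilation.lean`) reads `K` off the two-point function, makes it a power `c^{-Δ}` and
pins `w = ‖·‖^{2Δ}`.

Proof. (A) Run the landed eight-letter word `ι τ ι τ ι τ ι τ = D_{m²}` of
`PrecisionLaplacianMoebiusLimitOfTwoPointLawInversionBegetsDilations` (p127660) with the weighted inversion: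
at pole-free configurations `S n (m² x) = (∏ Ω(x i)) · S n x`, `Ω(y)` the product of `w` at the four points
met (`weighted_word`). (B) `n = 2`, translation invariance and `S₂ > 0` give `Ω(p+b)Ω(q+b) = Ω(p)Ω(q)`
(`Omega_translate`), whence by a three-point argument `Ω` is CONSTANT on pole-free points (`Omega_const`),
so `S n (m² x) = Kⁿ S n x` everywhere, poles dodged by a generic translation (`dilation_const`); every
`c > 1` is an `m²`, `c < 1` follows at `c • x`. Continuity of `S` or `w` and normalisation are not used.
References: Di Francesco–Mathieu–Sénéchal 1997 §4.1; the word and its pole bookkeeping are the tree's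
(p127660, p86170). [folklore]
-/

noncomputable section

namespace Summit.CriticalPhenomena.Ising3DConformalLimit.ReflectionTwinExistsContinuousLimit

open Literature.Probability.LatticeModels EuclideanGeometry
open Summit.CriticalPhenomena.Ising3DConformalLimit.PrecisionLaplacianMoebiusLimitOfTwoPointLaw

/-! ### The word of p127660 (local notations, verbatim) and the weighted cocycle `Ω` -/

/-- `m = 1 + τ²`. -/
local notation "mOf(" τ ")" => ((1 : ℝ) + τ ^ 2)
/-- `N₁ = ‖y − (τ/m) a‖²`. -/
local notation "N1(" a ", " y ", " τ ")" =>
  (‖y‖ ^ 2 + 2 * (-(τ / mOf(τ))) * inner ℝ y a + (-(τ / mOf(τ))) ^ 2)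
/-- `R = τ (N₁ − 1/m)`. -/
local notation "R1(" a ", " y ", " τ ")" => (τ * (N1(a, y, τ) - 1 / mOf(τ)))
/-- `M₁ = m⁻² + 2(τ/m)⟪y,a⟫ + τ²‖y‖²`. -/
local notation "M1(" a ", " y ", " τ ")" =>
  ((mOf(τ) ^ 2)⁻¹ + 2 * (τ / mOf(τ)) * inner ℝ y a + τ ^ 2 * ‖y‖ ^ 2)
/-- `z₁ = y − (τ/m) a`. -/
local notation "z1(" a ", " y ", " τ ")" => (y + (-(τ / mOf(τ))) • a)
/-- `z₂ = ι z₁ + τ a`. -/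
local notation "z2(" a ", " y ", " τ ")" => (inversion 0 1 (z1(a, y, τ)) + τ • a)
/-- `z₃ = ι z₂ + τ a`. -/
local notation "z3(" a ", " y ", " τ ")" => (inversion 0 1 (z2(a, y, τ)) + τ • a)
/-- `z₄ = ι z₃ − (τ/m) a`. -/
local notation "z4(" a ", " y ", " τ ")" =>
  (inversion 0 1 (z3(a, y, τ)) + (-(τ / mOf(τ))) • a)
/-- The weighted cocycle of the word: `Ω(y) = w(z₁) w(z₂) w(z₃) w(z₄)`. -/
local notation "Ω(" w ", " a ", " y ", " τ ")" =>
  (w (z1(a, y, τ)) * w (z2(a, y, τ)) * w (z3(a, y, τ)) * w (z4(a, y, τ)))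

/-! ### Elementary bookkeeping -/

/-- Three-point cancellation: `A'Q_b = AQ`, `A'R_b = AR`, `Q_bR_b = QR` with everything positive force
`A' = A`. [folklore] -/
theorem three_point_cancel {A A' Q R Qb Rb : ℝ} (hA : 0 < A) (hA' : 0 < A') (hQ : 0 < Q) (hR : 0 < R)
    (i1 : A' * Qb = A * Q) (i2 : A' * Rb = A * R) (i3 : Qb * Rb = Q * R) : A' = A := by
  have h : A' ^ 2 * (Q * R) = A ^ 2 * (Q * R) := by
    calc A' ^ 2 * (Q * R) = A' ^ 2 * (Qb * Rb) := by rw [i3]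
      _ = (A' * Qb) * (A' * Rb) := by ring
      _ = (A * Q) * (A * R) := by rw [i1, i2]
      _ = A ^ 2 * (Q * R) := by ring
  have h2 := mul_right_cancel₀ (mul_pos hQ hR).ne' h
  exact (pow_left_inj₀ hA'.le hA.le two_ne_zero).1 h2

/-! ### (A) The weighted word -/

section Word

variable {a : EuclideanSpace ℝ (Fin 3)} (ha : ‖a‖ = 1) {τ : ℝ}
include ha

/-- At a pole-free point the four points of the word are nonzero. [folklore] -/
theorem z_ne_zero {y : EuclideanSpace ℝ (Fin 3)} (hy : y ≠ 0) (hN : N1(a, y, τ) ≠ 0)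
    (hM : M1(a, y, τ) ≠ 0) :
    z1(a, y, τ) ≠ 0 ∧ z2(a, y, τ) ≠ 0 ∧ z3(a, y, τ) ≠ 0 ∧ z4(a, y, τ) ≠ 0 := by
  have key := weight_prod ha hy hN hM
  have hm : (mOf(τ))⁻¹ ≠ 0 := inv_ne_zero (mOf_ne τ)
  refine ⟨fun h => ?_, fun h => ?_, fun h => ?_, fun h => ?_⟩
  · rw [h, norm_zero, zero_mul, zero_mul, zero_mul] at key; exact hm key.symm
  · rw [h, norm_zero, mul_zero, zero_mul, zero_mul] at key; exact hm key.symm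
  · rw [h, norm_zero, mul_zero, zero_mul] at key; exact hm key.symm
  · rw [h, norm_zero, mul_zero] at key; exact hm key.symm

/-- The poles of the word are the three points `0`, `(τ/m) a`, `−(τ⁻¹ m⁻¹) a` (`τ ≠ 0`): away from them a
point is pole-free. [folklore] -/
theorem poleFree (hτ : τ ≠ 0) {y : EuclideanSpace ℝ (Fin 3)} (h0 : y ≠ 0)
    (h1 : y ≠ (τ / mOf(τ)) • a) (h2 : y ≠ (-(τ⁻¹ * (mOf(τ))⁻¹)) • a) :
    y ≠ 0 ∧ N1(a, y, τ) ≠ 0 ∧ M1(a, y, τ) ≠ 0 := by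
  refine ⟨h0, fun hN0 => ?_, fun hM0 => ?_⟩
  · have hz : z1(a, y, τ) = 0 := by
      have h := normsq_z1 ha y τ
      rw [hN0] at h
      exact norm_eq_zero.1 (pow_eq_zero_iff two_ne_zero |>.1 h)
    apply h1
    rw [neg_smul, ← sub_eq_add_neg, sub_eq_zero] at hz
    exact hz
  · rw [M1_eq_normsq ha] at hM0
    have hz : τ • y + (mOf(τ))⁻¹ • a = 0 := norm_eq_zero.1 (pow_eq_zero_iff two_ne_zero |>.1 hM0)
    apply h2
    have h' : τ • y = -((mOf(τ))⁻¹ • a) := eq_neg_of_add_eq_zero_left hz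
    have h'' : y = τ⁻¹ • (τ • y) := by rw [smul_smul, inv_mul_cancel₀ hτ, one_smul]
    rw [h'', h', smul_neg, smul_smul, neg_smul]

variable {S : CorrFamily 3} {w : EuclideanSpace ℝ (Fin 3) → ℝ}

/-- **(A) The weighted word.** At a configuration avoiding the three poles, a translation-invariant
family covariant under the unit inversion with weight `w` transforms under the dilation by `m²` with the
cocycle `∏ Ω(x i)`: four uses of weighted inversion covariance, four of translation invariance.
[folklore] -/
theorem weighted_word (htr : IsTranslationInvariant S)
    (hcov : ∀ (n : ℕ) (x : Fin n → EuclideanSpace ℝ (Fin 3)), (∀ i, x i ≠ 0) →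
      S n (fun i => inversion (0 : EuclideanSpace ℝ (Fin 3)) 1 (x i)) = (∏ i, w (x i)) * S n x)
    (τ : ℝ) {n : ℕ} (x : Fin n → EuclideanSpace ℝ (Fin 3))
    (hx0 : ∀ i, x i ≠ 0) (hxN : ∀ i, N1(a, x i, τ) ≠ 0) (hxM : ∀ i, M1(a, x i, τ) ≠ 0) :
    S n (fun i => (mOf(τ) ^ 2) • x i) = (∏ i, Ω(w, a, x i, τ)) * S n x := by
  have h1 : ∀ i, z1(a, x i, τ) ≠ 0 := fun i => (z_ne_zero ha (hx0 i) (hxN i) (hxM i)).1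
  have h2 : ∀ i, z2(a, x i, τ) ≠ 0 := fun i => (z_ne_zero ha (hx0 i) (hxN i) (hxM i)).2.1
  have h3 : ∀ i, z3(a, x i, τ) ≠ 0 := fun i => (z_ne_zero ha (hx0 i) (hxN i) (hxM i)).2.2.1
  have h4 : ∀ i, z4(a, x i, τ) ≠ 0 := fun i => (z_ne_zero ha (hx0 i) (hxN i) (hxM i)).2.2.2
  have hcfg : (fun i => (mOf(τ) ^ 2) • x i) = fun i => inversion 0 1 (z4(a, x i, τ)) :=
    funext fun i => (inversion_z4 ha (hx0 i) (hxN i) (hxM i)).symm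
  have t4 := htr n ((-(τ / mOf(τ))) • a) (fun i => inversion 0 1 (z3(a, x i, τ)))
  have t3 := htr n (τ • a) (fun i => inversion 0 1 (z2(a, x i, τ)))
  have t2 := htr n (τ • a) (fun i => inversion 0 1 (z1(a, x i, τ)))
  have t1 : S n (fun i => z1(a, x i, τ)) = S n x := htr n ((-(τ / mOf(τ))) • a) x
  rw [hcfg, hcov n _ h4, t4, hcov n _ h3, t3, hcov n _ h2, t2, hcov n _ h1, t1,
    ← mul_assoc, ← mul_assoc, ← mul_assoc]
  congr 1
  rw [← Finset.prod_mul_distrib, ← Finset.prod_mul_distrib, ← Finset.prod_mul_distrib]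
  refine Finset.prod_congr rfl fun i _ => ?_
  ring

/-- `Ω > 0` at a pole-free point (the weight is positive off the origin). [folklore] -/
theorem Omega_pos (hwpos : ∀ v, v ≠ 0 → 0 < w v) {y : EuclideanSpace ℝ (Fin 3)} (hy : y ≠ 0)
    (hN : N1(a, y, τ) ≠ 0) (hM : M1(a, y, τ) ≠ 0) : 0 < Ω(w, a, y, τ) := by
  obtain ⟨h1, h2, h3, h4⟩ := z_ne_zero ha hy hN hM
  exact mul_pos (mul_pos (mul_pos (hwpos _ h1) (hwpos _ h2)) (hwpos _ h3)) (hwpos _ h4)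

/-! ### (B) The cocycle is constant -/

/-- The two-point instance of the weighted word: `S₂(m²p, m²q) = Ω(p) Ω(q) S₂(p, q)` at pole-free `p, q`.
[folklore] -/
theorem weighted_word_two (htr : IsTranslationInvariant S)
    (hcov : ∀ (n : ℕ) (x : Fin n → EuclideanSpace ℝ (Fin 3)), (∀ i, x i ≠ 0) →
      S n (fun i => inversion (0 : EuclideanSpace ℝ (Fin 3)) 1 (x i)) = (∏ i, w (x i)) * S n x)
    (τ : ℝ) {p q : EuclideanSpace ℝ (Fin 3)}
    (hp : p ≠ 0 ∧ N1(a, p, τ) ≠ 0 ∧ M1(a, p, τ) ≠ 0) (hq : q ≠ 0 ∧ N1(a, q, τ) ≠ 0 ∧ M1(a, q, τ) ≠ 0) :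
    S 2 ![(mOf(τ) ^ 2) • p, (mOf(τ) ^ 2) • q] = Ω(w, a, p, τ) * Ω(w, a, q, τ) * S 2 ![p, q] := by
  have key := weighted_word ha htr hcov τ ![p, q]
    (fun i => by fin_cases i <;> simp [hp.1, hq.1])
    (fun i => by fin_cases i; exacts [hp.2.1, hq.2.1])
    (fun i => by fin_cases i; exacts [hp.2.2, hq.2.2])
  have hcfg : (fun i => (mOf(τ) ^ 2) • (![p, q] : Fin 2 → EuclideanSpace ℝ (Fin 3)) i)
      = ![(mOf(τ) ^ 2) • p, (mOf(τ) ^ 2) • q] := by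
    funext i; fin_cases i <;> simp
  rw [hcfg] at key
  rw [key, Fin.prod_univ_two]
  simp only [Matrix.cons_val_zero, Matrix.cons_val_one]

/-- **Translation identity of the cocycle**: `Ω(p+b) Ω(q+b) = Ω(p) Ω(q)` for `p ≠ q` with
`p, q, p+b, q+b` pole-free (translation invariance and positivity of `S₂`). [folklore] -/
theorem Omega_translate (htr : IsTranslationInvariant S) (hnd : IsNondegenerateTwoPoint S)
    (hcov : ∀ (n : ℕ) (x : Fin n → EuclideanSpace ℝ (Fin 3)), (∀ i, x i ≠ 0) →
      S n (fun i => inversion (0 : EuclideanSpace ℝ (Fin 3)) 1 (x i)) = (∏ i, w (x i)) * S n x)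
    (τ : ℝ) {p q b : EuclideanSpace ℝ (Fin 3)} (hpq : p ≠ q)
    (hp : p ≠ 0 ∧ N1(a, p, τ) ≠ 0 ∧ M1(a, p, τ) ≠ 0) (hq : q ≠ 0 ∧ N1(a, q, τ) ≠ 0 ∧ M1(a, q, τ) ≠ 0)
    (hpb : p + b ≠ 0 ∧ N1(a, p + b, τ) ≠ 0 ∧ M1(a, p + b, τ) ≠ 0)
    (hqb : q + b ≠ 0 ∧ N1(a, q + b, τ) ≠ 0 ∧ M1(a, q + b, τ) ≠ 0) :
    Ω(w, a, p + b, τ) * Ω(w, a, q + b, τ) = Ω(w, a, p, τ) * Ω(w, a, q, τ) := by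
  have k1 := weighted_word_two ha htr hcov τ hp hq
  have k2 := weighted_word_two ha htr hcov τ hpb hqb
  have hpos : 0 < S 2 ![p, q] := hnd _ (pair_mem_nonCoincident hpq)
  -- translate the dilated pair back
  have e1 : S 2 ![(mOf(τ) ^ 2) • (p + b), (mOf(τ) ^ 2) • (q + b)]
      = S 2 ![(mOf(τ) ^ 2) • p, (mOf(τ) ^ 2) • q] := by
    have h := htr 2 ((mOf(τ) ^ 2) • b) ![(mOf(τ) ^ 2) • p, (mOf(τ) ^ 2) • q]
    have hcfg : (fun i => (![(mOf(τ) ^ 2) • p, (mOf(τ) ^ 2) • q] : Fin 2 → EuclideanSpace ℝ (Fin 3)) i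
        + (mOf(τ) ^ 2) • b) = ![(mOf(τ) ^ 2) • (p + b), (mOf(τ) ^ 2) • (q + b)] := by
      funext i; fin_cases i <;> simp [smul_add]
    rw [hcfg] at h
    exact h
  have e2 : S 2 ![p + b, q + b] = S 2 ![p, q] := by
    have h := htr 2 b ![p, q]
    have hcfg : (fun i => (![p, q] : Fin 2 → EuclideanSpace ℝ (Fin 3)) i + b) = ![p + b, q + b] := by
      funext i; fin_cases i <;> simp
    rw [hcfg] at h
    exact h
  rw [e1, k1, e2] at k2
  exact (mul_right_cancel₀ hpos.ne' k2).symm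

/-- **(B) The cocycle is constant on pole-free points** (three-point argument: with auxiliary pole-free
`q, r` off `p`, `Ω(p')² Ω(q)Ω(r) = Ω(p)² Ω(q)Ω(r)`). [folklore] -/
theorem Omega_const (htr : IsTranslationInvariant S) (hnd : IsNondegenerateTwoPoint S)
    (hwpos : ∀ v, v ≠ 0 → 0 < w v)
    (hcov : ∀ (n : ℕ) (x : Fin n → EuclideanSpace ℝ (Fin 3)), (∀ i, x i ≠ 0) →
      S n (fun i => inversion (0 : EuclideanSpace ℝ (Fin 3)) 1 (x i)) = (∏ i, w (x i)) * S n x)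
    (hτ : τ ≠ 0) {p p' : EuclideanSpace ℝ (Fin 3)}
    (hp : p ≠ 0 ∧ N1(a, p, τ) ≠ 0 ∧ M1(a, p, τ) ≠ 0) (hp' : p' ≠ 0 ∧ N1(a, p', τ) ≠ 0 ∧ M1(a, p', τ) ≠ 0) :
    Ω(w, a, p', τ) = Ω(w, a, p, τ) := by
  have ha0 : a ≠ 0 := by rw [← norm_ne_zero_iff, ha]; exact one_ne_zero
  haveI : Infinite (EuclideanSpace ℝ (Fin 3)) :=
    Infinite.of_injective (fun c : ℝ => c • a) (smul_left_injective ℝ ha0)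
  set b : EuclideanSpace ℝ (Fin 3) := p' - p with hb
  set p₁ : EuclideanSpace ℝ (Fin 3) := (τ / mOf(τ)) • a with hp₁
  set p₂ : EuclideanSpace ℝ (Fin 3) := (-(τ⁻¹ * (mOf(τ))⁻¹)) • a with hp₂
  -- the finite bad set: a point outside it is pole-free, so is its translate by `b`, and it is off `p`
  have good : ∀ y : EuclideanSpace ℝ (Fin 3), y ∉ ({p, 0, p₁, p₂, -b, p₁ - b, p₂ - b} : Finset _) →
      y ≠ p ∧ (y ≠ 0 ∧ N1(a, y, τ) ≠ 0 ∧ M1(a, y, τ) ≠ 0) ∧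
        (y + b ≠ 0 ∧ N1(a, y + b, τ) ≠ 0 ∧ M1(a, y + b, τ) ≠ 0) := by
    intro y hy
    simp only [Finset.mem_insert, Finset.mem_singleton, not_or] at hy
    obtain ⟨h1, h2, h3, h4, h5, h6, h7⟩ := hy
    refine ⟨h1, poleFree ha hτ h2 h3 h4, poleFree ha hτ ?_ ?_ ?_⟩
    · intro h; exact h5 (eq_neg_of_add_eq_zero_left h)
    · intro h; exact h6 (eq_sub_of_add_eq h)
    · intro h; exact h7 (eq_sub_of_add_eq h)
  obtain ⟨q, hqmem⟩ := Infinite.exists_notMem_finset ({p, 0, p₁, p₂, -b, p₁ - b, p₂ - b} : Finset _)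
  obtain ⟨hqp, hq, hqb⟩ := good q hqmem
  obtain ⟨r, hrmem⟩ := Infinite.exists_notMem_finset
    (insert q ({p, 0, p₁, p₂, -b, p₁ - b, p₂ - b} : Finset _))
  rw [Finset.mem_insert, not_or] at hrmem
  obtain ⟨hrq, hrmem⟩ := hrmem
  obtain ⟨hrp, hr, hrb⟩ := good r hrmem
  have hpb : p + b = p' := by rw [hb]; abel
  have hp'b : p + b ≠ 0 ∧ N1(a, p + b, τ) ≠ 0 ∧ M1(a, p + b, τ) ≠ 0 := by rw [hpb]; exact hp'
  have i1 := Omega_translate ha htr hnd hcov τ (Ne.symm hqp) hp hq hp'b hqb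
  have i2 := Omega_translate ha htr hnd hcov τ (Ne.symm hrp) hp hr hp'b hrb
  have i3 := Omega_translate ha htr hnd hcov τ (Ne.symm hrq) hq hr hqb hrb
  rw [hpb] at i1 i2
  exact three_point_cancel (Omega_pos ha hwpos hp.1 hp.2.1 hp.2.2) (Omega_pos ha hwpos hp'.1 hp'.2.1 hp'.2.2)
    (Omega_pos ha hwpos hq.1 hq.2.1 hq.2.2) (Omega_pos ha hwpos hr.1 hr.2.1 hr.2.2) i1 i2 i3

/-- **The word dilates with a CONSTANT cocycle**: for `τ ≠ 0` there is `K > 0` with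
`S n (m² x) = Kⁿ S n x` for every configuration (poles dodged by a generic translation). [folklore] -/
theorem dilation_const (htr : IsTranslationInvariant S) (hnd : IsNondegenerateTwoPoint S)
    (hwpos : ∀ v, v ≠ 0 → 0 < w v)
    (hcov : ∀ (n : ℕ) (x : Fin n → EuclideanSpace ℝ (Fin 3)), (∀ i, x i ≠ 0) →
      S n (fun i => inversion (0 : EuclideanSpace ℝ (Fin 3)) 1 (x i)) = (∏ i, w (x i)) * S n x)
    (hτ : τ ≠ 0) :
    ∃ K : ℝ, 0 < K ∧ ∀ (n : ℕ) (x : Fin n → EuclideanSpace ℝ (Fin 3)),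
      S n (fun i => (mOf(τ) ^ 2) • x i) = K ^ n * S n x := by
  have ha0 : a ≠ 0 := by rw [← norm_ne_zero_iff, ha]; exact one_ne_zero
  haveI : Infinite (EuclideanSpace ℝ (Fin 3)) :=
    Infinite.of_injective (fun c : ℝ => c • a) (smul_left_injective ℝ ha0)
  set p₁ : EuclideanSpace ℝ (Fin 3) := (τ / mOf(τ)) • a with hp₁
  set p₂ : EuclideanSpace ℝ (Fin 3) := (-(τ⁻¹ * (mOf(τ))⁻¹)) • a with hp₂
  -- a reference pole-free point and the constant
  obtain ⟨y₀, hy₀⟩ := Infinite.exists_notMem_finset ({0, p₁, p₂} : Finset (EuclideanSpace ℝ (Fin 3)))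
  simp only [Finset.mem_insert, Finset.mem_singleton, not_or] at hy₀
  have hpf₀ := poleFree ha hτ hy₀.1 hy₀.2.1 hy₀.2.2
  refine ⟨Ω(w, a, y₀, τ), Omega_pos ha hwpos hpf₀.1 hpf₀.2.1 hpf₀.2.2, fun n x => ?_⟩
  -- generic translation making every point pole-free
  obtain ⟨u, hu⟩ := Infinite.exists_notMem_finset
    (Finset.univ.image (fun i => -x i) ∪ Finset.univ.image (fun i => p₁ - x i) ∪
      Finset.univ.image (fun i => p₂ - x i))
  simp only [Finset.mem_union, Finset.mem_image, Finset.mem_univ, true_and, not_or,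
    not_exists] at hu
  obtain ⟨⟨hu0, hu1⟩, hu2⟩ := hu
  have hpf : ∀ i, x i + u ≠ 0 ∧ N1(a, x i + u, τ) ≠ 0 ∧ M1(a, x i + u, τ) ≠ 0 := by
    intro i
    refine poleFree ha hτ (fun h => hu0 i (add_eq_zero_iff_neg_eq.1 h)) (fun h => ?_) (fun h => ?_)
    · exact hu1 i (sub_eq_iff_eq_add.2 (h.symm.trans (add_comm _ _)))
    · exact hu2 i (sub_eq_iff_eq_add.2 (h.symm.trans (add_comm _ _)))
  have key := weighted_word ha htr hcov τ (fun i => x i + u) (fun i => (hpf i).1)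
    (fun i => (hpf i).2.1) (fun i => (hpf i).2.2)
  rw [htr n u x] at key
  have hcfg : (fun i => (mOf(τ) ^ 2) • (x i + u)) = fun i => (mOf(τ) ^ 2) • x i + (mOf(τ) ^ 2) • u :=
    funext fun i => smul_add _ _ _
  rw [hcfg, htr n _ (fun i => (mOf(τ) ^ 2) • x i)] at key
  rw [key]
  congr 1
  rw [Finset.prod_eq_pow_card, Finset.card_univ, Fintype.card_fin]
  intro i _
  exact Omega_const ha htr hnd hwpos hcov hτ hpf₀ (hpf i)

end Word

/-! ### Every dilation, with a constant cocycle -/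

/-- **Registered sub-goal `dilation_const_of_pos` (K2 part 1): every `c > 0` dilates a
translation-invariant, weighted-inversion-covariant family with positive two-point function by a CONSTANT
cocycle `Kⁿ`, `K > 0`.** [folklore] -/
theorem dilation_const_of_pos :
    ∀ (S : Literature.Probability.LatticeModels.CorrFamily 3) (w : EuclideanSpace ℝ (Fin 3) → ℝ),
      Literature.Probability.LatticeModels.IsTranslationInvariant S →
      Literature.Probability.LatticeModels.IsNondegenerateTwoPoint S →
      (∀ v, v ≠ 0 → 0 < w v) →
      (∀ (n : ℕ) (x : Fin n → EuclideanSpace ℝ (Fin 3)), (∀ i, x i ≠ 0) →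
        S n (fun i => EuclideanGeometry.inversion (0 : EuclideanSpace ℝ (Fin 3)) 1 (x i)) =
          (∏ i, w (x i)) * S n x) →
      ∀ c : ℝ, 0 < c → ∃ K : ℝ, 0 < K ∧ ∀ (n : ℕ) (x : Fin n → EuclideanSpace ℝ (Fin 3)),
        S n (fun i => c • x i) = K ^ n * S n x := by
  intro S w htr hnd hwpos hcov c hc
  -- `c > 1`: `c = m²`, `m = 1 + τ²`, `τ = √(√c − 1)`
  have hgt : ∀ {c : ℝ}, 1 < c → ∃ K : ℝ, 0 < K ∧ ∀ (n : ℕ) (x : Fin n → EuclideanSpace ℝ (Fin 3)),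
      S n (fun i => c • x i) = K ^ n * S n x := by
    intro c hc
    set τ : ℝ := Real.sqrt (Real.sqrt c - 1) with hτ
    have hsc : 1 < Real.sqrt c := by
      rw [show (1:ℝ) = Real.sqrt 1 by simp]
      exact Real.sqrt_lt_sqrt zero_le_one hc
    have hτpos : 0 < τ := Real.sqrt_pos.2 (by linarith)
    have hm : mOf(τ) = Real.sqrt c := by
      rw [hτ, Real.sq_sqrt (by linarith)]
      ring
    have hm2 : mOf(τ) ^ 2 = c := by rw [hm, Real.sq_sqrt (by linarith)]
    obtain ⟨a, ha⟩ := exists_norm_eq (EuclideanSpace ℝ (Fin 3)) zero_le_one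
    obtain ⟨K, hK, h⟩ := dilation_const ha htr hnd hwpos hcov hτpos.ne'
    rw [hm2] at h
    exact ⟨K, hK, h⟩
  rcases lt_trichotomy c 1 with hlt | rfl | hgt'
  · obtain ⟨K, hK, h⟩ := hgt ((one_lt_inv₀ hc).2 hlt)
    refine ⟨K⁻¹, inv_pos.2 hK, fun n x => ?_⟩
    have key := h n (fun i => c • x i)
    have hcfg : (fun i => c⁻¹ • (c • x i)) = x := by
      funext i; rw [smul_smul, inv_mul_cancel₀ hc.ne', one_smul]
    rw [hcfg] at key
    rw [key, ← mul_assoc, inv_pow, inv_mul_cancel₀ (pow_ne_zero n hK.ne'), one_mul]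
  · exact ⟨1, one_pos, fun n x => by simp⟩
  · exact hgt hgt'

end Summit.CriticalPhenomena.Ising3DConformalLimit.ReflectionTwinExistsContinuousLimit

end
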